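import Summits.Ventures.HSemireg.WedgeHankelSiegel

/-!
# Venture HSemireg — THE SIEGEL IDEAL (1/3): the symmetrisation homomorphism `x_a ↦ u_a`, `y_a ↦ u_a·t`, and the degree-`k` Siegel ideal
# `SI_k = ⋀^{k−2} ∧ Siegel_n` — killed by EVERY Hankel class `w_n(q)` and by the symmetrisation

HONEST FRAMING. Part of the Lean index of the computation cell `pub-hsemireg` (seat p10 gen 11, Sunday typer «UNIFORM-IN-n»).
Finite-dimensional EXTERIOR ALGEBRA over a field (and polynomials in one central variable over it) ONLY: no variety, no cohomology
theory, no sheaf, no Ext group and no semiregularity map is constructed here; nothing here says that HC / HC_CM / HC_AV holds; no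
Literature fact is declared or used.  Custodian versions cited: theory/FORMULA-N.md PART A §2.6 THEOREM H and FN-4 (i) («rank(⌟v ∣ HT^k(X))
= C(n,k)·rank H_k(v), with v-independent kernel the Θ-isotropic part»), PART B §N.8 (th-7's recursion `w₀(q) = q₀·1`, `w_{j+1}(q) = w_j(q)·x_j
+ w_j(σq)·y_j`); STRUCTURE.md v1.0-SIGNED 9b196a05977dd067 §1.1 C15.  The dictionary (`v = Σ_j q_j Θ^j/j!` ↦ `w_n(q)`; `x_a ↔ ∂_a`, `y_a ↔ dz̄_a`;
`⌟v` on `HT^k` ↦ `θ ↦ θ ∧ w_n(q)` on `⋀^k K^{2n}`) is QUOTED, never asserted.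

WHAT IS IN THE TREE / KEYED.  THEOREM H (`WedgeHankelModel.hankelLaw_model`): `dim range(θ ↦ θ ∧ w_n(q) ∣ ⋀^k) = C(n,k)·rank H_k(q)` for every
field, `n`, `k`, `q`.  p10 g10's `WedgeHankelSiegel` (ladder row 622): the SIEGEL SPACE `Siegel_n = span{x_a y_b + x_b y_a, x_a y_a} ⊆ ⋀²` is
killed by every `w_n(q)`, has dimension `n(n+1)/2`, is the whole degree-`2` kernel at the generic rank, and `(η ∧ θ) ∧ w_n(q) = 0` for
`θ ∈ Siegel_n` — «its dimension in degree `k` is not computed».  THIS FILE and its two sequels (`WedgeHankelSiegelIdealMonomials`,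
`WedgeHankelSiegelIdealKernel`) compute the ideal generated by the Siegel space in EVERY degree and identify it twice over:
* §1 **THE SYMMETRISATION HOMOMORPHISM** `sym : ⋀(K^{2n}) →ₐ ⋀(K^n)[t]`, `x_a ↦ u_a`, `y_a ↦ u_a·t` (`ExteriorAlgebra.lift` of a square-zero
  linear map: `(ι v_x + ι v_y·t)² = (ι v_x ι v_y + ι v_y ι v_x)·t = 0`, `t` central); **`sym_sv`: it KILLS the Siegel 2-vectors**
  (`sym (x_a y_b + x_b y_a) = (u_a u_b + u_b u_a)·t = 0`, `sym (x_a y_a) = u_a²·t = 0`).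
* §2 **THE SIEGEL IDEAL IN DEGREE `k`**: `SI_k := span{E_t ∧ s_{ab} : |t| + 2 = k, a ≤ b < n} ⊆ ⋀^k` (`siegelIdeal`; `siegelIdeal_two`:
  `SI_2 = Siegel_n`); **`mul_w_eq_zero_of_mem_siegelIdeal` / `siegelIdeal_le_ker`: `SI_k ≤ ker(θ ↦ θ ∧ w_n(q) ∣ ⋀^k)` for EVERY field, `n`,
  `k`, `q`**; **`sym_eq_zero_of_mem_siegelIdeal`: `SI_k ≤ ker sym`**.
* §3 `sym` on the pure monomials: `sym (x_P) = c·u_P`, `sym (y_Q) = c·u_Q·t^{|Q|}` with `c ≠ 0` (SIGN-FREE, as everywhere in th-7's model: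
  structure constants are units and are never evaluated).
The sequels prove `dim SI_k = C(2n,k) − (k+1)·C(n,k)` (2/3) and `SI_k = ker(sym ∣ ⋀^k) = ⋂_q ker(θ ↦ θ ∧ w_n(q) ∣ ⋀^k)` (`2k ≤ n`) with the
EXCESS LAW `dim ker(θ ↦ θ ∧ w_n(q) ∣ ⋀^k) = dim SI_k + C(n,k)·(k + 1 − rank H_k(q))` (3/3).  In the quoted dictionary: `SI_k` is th-6's
«Θ-isotropic part» in every degree, and `⋀^k / SI_k` (dimension `(k+1)·C(n,k)`) is the part of `HT^k` that polynomial-in-`Θ` classes can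
see at all.  NOT typed here: anything Ext-side; boxes of several factors.  Class side only.
Namespace `Summit.Ventures.HSemireg.Wedge.HankelSiegelIdeal` (new); new names only.
-/

open Module

namespace Summit.Ventures.HSemireg.Wedge.HankelSiegelIdeal

open Summit.Ventures.HSemireg.Wedge Summit.Ventures.HSemireg.Wedge.Hankel
  Summit.Ventures.HSemireg.Wedge.HankelSiegel

variable (K : Type*) [Field K] {n : ℕ}

/-! ## §1. The symmetrisation homomorphism `x_a ↦ u_a`, `y_a ↦ u_a·t` -/

/-- the target algebra: polynomials in one central variable `t` over the exterior algebra on `n` generators `u_a`. -/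
abbrev SymA (K : Type*) [Field K] (n : ℕ) : Type _ := Polynomial (HT K (Fin n))

/-- the `x`-half of a coefficient vector: `v ↦ (a ↦ v_{x_a})`. -/
noncomputable def xpart : (In n → K) →ₗ[K] (Fin n → K) := LinearMap.funLeft K K (Fin.castAdd n)

/-- the `y`-half of a coefficient vector: `v ↦ (a ↦ v_{y_a})`. -/
noncomputable def ypart : (In n → K) →ₗ[K] (Fin n → K) := LinearMap.funLeft K K (Fin.natAdd n)

/-- the symmetrisation on generators: `v ↦ ι(v_x) · t⁰ + ι(v_y) · t¹`. -/
noncomputable def symLin : (In n → K) →ₗ[K] SymA K n where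
  toFun v := Polynomial.monomial 0 (ExteriorAlgebra.ι K (xpart K v)) + Polynomial.monomial 1 (ExteriorAlgebra.ι K (ypart K v))
  map_add' v w := by
    simp only [map_add]
    abel
  map_smul' c v := by
    simp only [map_smul, smul_add, Polynomial.smul_monomial, RingHom.id_apply]

/-- the images of the generators square to zero (`ι(x)² = 0`, `ι(x)ι(y) + ι(y)ι(x) = 0`, `t` central). -/
lemma symLin_mul_self (v : In n → K) : symLin K v * symLin K v = 0 := by
  simp only [symLin, LinearMap.coe_mk, AddHom.coe_mk, mul_add, add_mul, Polynomial.monomial_mul_monomial,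
    ExteriorAlgebra.ι_sq_zero, map_zero, zero_add, add_zero]
  rw [← map_add, add_comm, ExteriorAlgebra.ι_add_mul_swap, map_zero]

/-- **THE SYMMETRISATION HOMOMORPHISM** `sym : ⋀(K^{2n}) → ⋀(K^n)[t]`, `x_a ↦ u_a`, `y_a ↦ u_a · t` (an algebra map by the universal
property of the exterior algebra). -/
noncomputable def sym : HT K (In n) →ₐ[K] SymA K n := ExteriorAlgebra.lift K ⟨symLin K, symLin_mul_self K⟩

/-- `sym` on a generator vector. -/
lemma sym_ι (v : In n → K) : sym K (ExteriorAlgebra.ι K v) = symLin K v :=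
  ExteriorAlgebra.lift_ι_apply K _ _ v

/-- the `x`-half of the basis vector `e_{x_a}` is `e_a`. -/
lemma xpart_b_castAdd (a : Fin n) : xpart K (b K (In n) (Fin.castAdd n a)) = b K (Fin n) a := by
  funext c
  simp only [xpart, LinearMap.funLeft_apply, b, Pi.basisFun_apply, Pi.single_apply, Fin.castAdd_inj]

/-- the `y`-half of `e_{x_a}` vanishes. -/
lemma ypart_b_castAdd (a : Fin n) : ypart K (b K (In n) (Fin.castAdd n a)) = 0 := by
  funext c
  simp only [ypart, LinearMap.funLeft_apply, b, Pi.basisFun_apply, Pi.single_apply, Pi.zero_apply]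
  rw [if_neg]
  intro h
  have := congrArg Fin.val h
  simp [Fin.natAdd, Fin.castAdd] at this
  omega

/-- the `x`-half of `e_{y_a}` vanishes. -/
lemma xpart_b_natAdd (a : Fin n) : xpart K (b K (In n) (Fin.natAdd n a)) = 0 := by
  funext c
  simp only [xpart, LinearMap.funLeft_apply, b, Pi.basisFun_apply, Pi.single_apply, Pi.zero_apply]
  rw [if_neg]
  intro h
  have := congrArg Fin.val h
  simp [Fin.natAdd, Fin.castAdd] at this
  omega

/-- the `y`-half of `e_{y_a}` is `e_a`. -/
lemma ypart_b_natAdd (a : Fin n) : ypart K (b K (In n) (Fin.natAdd n a)) = b K (Fin n) a := by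
  funext c
  simp only [ypart, LinearMap.funLeft_apply, b, Pi.basisFun_apply, Pi.single_apply, Fin.natAdd_inj]

/-- a generator monomial of the target algebra is `ι` of the corresponding basis vector. -/
lemma gx_fin_eq_ι (a : Fin n) : gx K a = ExteriorAlgebra.ι K (b K (Fin n) a) := by
  rw [gx, B, ExteriorAlgebra.basis_apply_ofCard (b K (Fin n)) (Finset.card_singleton a)]
  simp [ExteriorAlgebra.ιMulti_family, ExteriorAlgebra.ιMulti_apply, Set.powersetCard.ofFinEmbEquiv_symm_apply]

/-- **`sym (x_a) = u_a`** (as `u_a · t⁰`). -/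
lemma sym_gx_castAdd (a : Fin n) : sym K (gx K (Fin.castAdd n a)) = Polynomial.monomial 0 (gx K a) := by
  rw [Hankel.gx_eq_ι, sym_ι, symLin, LinearMap.coe_mk, AddHom.coe_mk, xpart_b_castAdd, ypart_b_castAdd, map_zero,
    map_zero, add_zero, gx_fin_eq_ι]

/-- **`sym (y_a) = u_a · t`.** -/
lemma sym_gx_natAdd (a : Fin n) : sym K (gx K (Fin.natAdd n a)) = Polynomial.monomial 1 (gx K a) := by
  rw [Hankel.gx_eq_ι, sym_ι, symLin, LinearMap.coe_mk, AddHom.coe_mk, xpart_b_natAdd, ypart_b_natAdd, map_zero,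
    map_zero, zero_add, gx_fin_eq_ι]

/-- `sym (X_a) = u_a` in th-7's `ℕ`-indexed notation. -/
lemma sym_X (a : Fin n) : sym K (X K n a) = Polynomial.monomial 0 (gx K a) := by
  rw [X_fin, ← Hankel.gx_eq_ι, sym_gx_castAdd]

/-- `sym (Y_a) = u_a · t`. -/
lemma sym_Y (a : Fin n) : sym K (Y K n a) = Polynomial.monomial 1 (gx K a) := by
  rw [Y_fin, ← Hankel.gx_eq_ι, sym_gx_natAdd]

/-- **`sym` KILLS THE SIEGEL 2-VECTORS: `sym (x_a y_b + x_b y_a) = (u_a u_b + u_b u_a) · t = 0`, `sym (x_a y_a) = u_a² · t = 0`.** -/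
theorem sym_sv {a c : ℕ} (ha : a < n) (hc : c < n) : sym K (sv K (n := n) a c) = 0 := by
  have hX : ∀ (d : ℕ) (hd : d < n), sym K (X K n d) = Polynomial.monomial 0 (gx K (⟨d, hd⟩ : Fin n)) :=
    fun d hd => sym_X K ⟨d, hd⟩
  have hY : ∀ (d : ℕ) (hd : d < n), sym K (Y K n d) = Polynomial.monomial 1 (gx K (⟨d, hd⟩ : Fin n)) :=
    fun d hd => sym_Y K ⟨d, hd⟩
  unfold sv
  split_ifs with h
  · subst h
    rw [add_zero, map_mul, hX a ha, hY a ha, Polynomial.monomial_mul_monomial, gx_mul_self, map_zero]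
  · rw [map_add, map_mul, map_mul, hX a ha, hY c hc, hX c hc, hY a ha, Polynomial.monomial_mul_monomial,
      Polynomial.monomial_mul_monomial, zero_add, ← map_add, gy_mul_gx K (⟨a, ha⟩ : Fin n) ⟨c, hc⟩, add_neg_cancel, map_zero]

/-! ## §2. The Siegel ideal in degree `k` -/

/-- index of the spanning family of the degree-`k` Siegel ideal: a monomial support `t` with `|t| + 2 = k` and a Siegel pair `a ≤ b < n`. -/
abbrev IIdx (n k : ℕ) : Type := {t : Finset (In n) // t.card + 2 = k} × SIdx n

/-- the spanning family `E_t ∧ s_{ab}` of the degree-`k` Siegel ideal. -/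
noncomputable def igen {k : ℕ} (p : IIdx n k) : HT K (In n) := B K (In n) p.1.1 * sgen K p.2

/-- **THE SIEGEL IDEAL IN DEGREE `k`**: `SI_k := span{E_t ∧ s_{ab} : |t| + 2 = k, a ≤ b < n}` — the degree-`k` part of the ideal of `⋀(K^{2n})`
generated by the Siegel space (`WedgeHankelSiegel.siegel`). -/
noncomputable def siegelIdeal (n k : ℕ) : Submodule K (HT K (In n)) :=
  Submodule.span K (Set.range (igen K (n := n) (k := k)))

/-- the bounds of a Siegel pair index. -/
lemma SIdx_lt (p : SIdx n) : (p.2 : ℕ) < n ∧ (p.1 : ℕ) < n := ⟨by have := p.2.2; have := p.1.2; omega, p.1.2⟩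

/-- each generator `E_t ∧ s_{ab}` is homogeneous of degree `k`. -/
lemma igen_mem_exteriorPower {k : ℕ} (p : IIdx n k) : igen K p ∈ ⋀[K]^k (In n → K) := by
  obtain ⟨⟨t, ht⟩, s⟩ := p
  subst ht
  rw [exteriorPower_eq_Hom_univ]
  exact B_mul_mem_Hom K (Finset.subset_univ t) (sv_mem_Hom_two K _ _)

/-- `SI_k ⊆ ⋀^k`. -/
theorem siegelIdeal_le_exteriorPower (k : ℕ) : siegelIdeal K n k ≤ ⋀[K]^k (In n → K) := by
  rw [siegelIdeal, Submodule.span_le]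
  rintro _ ⟨p, rfl⟩
  exact igen_mem_exteriorPower K p

/-- each generator is killed by every Hankel class: `(E_t ∧ s_{ab}) ∧ w_n(q) = 0`. -/
lemma igen_mul_w {k : ℕ} (p : IIdx n k) (q : ℕ → K) : igen K p * w K n n q = 0 := by
  rw [igen, mul_assoc, sgen, sv_mul_w K (SIdx_lt p.2).1 (SIdx_lt p.2).2 q, mul_zero]

/-- **EVERY ELEMENT OF THE SIEGEL IDEAL IS KILLED BY EVERY HANKEL CLASS: `θ ∧ w_n(q) = 0` for `θ ∈ SI_k`, every `q`.** -/
theorem mul_w_eq_zero_of_mem_siegelIdeal {k : ℕ} {θ : HT K (In n)} (hθ : θ ∈ siegelIdeal K n k) (q : ℕ → K) :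
    θ * w K n n q = 0 := by
  induction hθ using Submodule.span_induction with
  | mem x hx => obtain ⟨p, rfl⟩ := hx; exact igen_mul_w K p q
  | zero => rw [zero_mul]
  | add x y _ _ hx hy => rw [add_mul, hx, hy, add_zero]
  | smul c x _ hx => rw [smul_mul_assoc, hx, smul_zero]

/-- **`SI_k ≤ ker(θ ↦ θ ∧ w_n(q) ∣ ⋀^k)` for every field, every `n`, `k`, `q`** (the ideal form of `WedgeHankelSiegel.siegel_le_ker`). -/
theorem siegelIdeal_le_ker (k : ℕ) (q : ℕ → K) :
    (siegelIdeal K n k).comap (⋀[K]^k (In n → K)).subtype ≤ LinearMap.ker (Hankel.wedge K n k (w K n n q)) := by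
  intro θ hθ
  rw [LinearMap.mem_ker, Hankel.wedge, LinearMap.comp_apply, Submodule.subtype_apply, LinearMap.mulRight_apply]
  exact mul_w_eq_zero_of_mem_siegelIdeal K hθ q

/-- `sym` kills each generator of the Siegel ideal. -/
lemma sym_igen {k : ℕ} (p : IIdx n k) : sym K (igen K p) = 0 := by
  rw [igen, map_mul, sgen, sym_sv K (SIdx_lt p.2).1 (SIdx_lt p.2).2, mul_zero]

/-- **`sym` VANISHES ON THE SIEGEL IDEAL** (it is an algebra map killing the Siegel space). -/
theorem sym_eq_zero_of_mem_siegelIdeal {k : ℕ} {θ : HT K (In n)} (hθ : θ ∈ siegelIdeal K n k) : sym K θ = 0 := by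
  induction hθ using Submodule.span_induction with
  | mem x hx => obtain ⟨p, rfl⟩ := hx; exact sym_igen K p
  | zero => rw [map_zero]
  | add x y _ _ hx hy => rw [map_add, hx, hy, add_zero]
  | smul c x _ hx => rw [map_smul, hx, smul_zero]

/-- in degree `2` the Siegel ideal is the Siegel space itself. -/
theorem siegelIdeal_two : siegelIdeal K n 2 = siegel K n := by
  have hB : B K (In n) (∅ : Finset (In n)) = 1 := B_empty K
  apply le_antisymm
  · rw [siegelIdeal, Submodule.span_le]
    rintro _ ⟨⟨⟨t, ht⟩, p⟩, rfl⟩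
    have ht0 : t = ∅ := Finset.card_eq_zero.mp (by omega)
    subst ht0
    rw [igen, hB, one_mul]
    exact Submodule.subset_span ⟨p, rfl⟩
  · rw [siegel, Submodule.span_le]
    rintro _ ⟨p, rfl⟩
    have h : igen K ((⟨∅, by simp⟩, p) : IIdx n 2) ∈ siegelIdeal K n 2 := Submodule.subset_span ⟨_, rfl⟩
    rwa [igen, hB, one_mul] at h


/-! ## §3. `sym` on monomials: the standard monomials `x_{S∖A} y_A` have independent images `u_S · t^{|A|}` -/

/-- the empty monomial of the target algebra is `1`. -/
lemma B_fin_empty : B K (Fin n) (∅ : Finset (Fin n)) = 1 := by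
  rw [B, ExteriorAlgebra.basis_apply_ofCard (b K (Fin n)) Finset.card_empty]
  simp [ExteriorAlgebra.ιMulti_family]

/-- the `x`-indices of a set of pairs. -/
def xs (P : Finset (Fin n)) : Finset (In n) := P.map (Fin.castAddEmb n)

/-- the `y`-indices of a set of pairs. -/
def ys (Q : Finset (Fin n)) : Finset (In n) := Q.map (Fin.natAddEmb n)

/-- `xs` of an insertion. -/
lemma xs_insert (a : Fin n) (P : Finset (Fin n)) : xs (insert a P) = insert (Fin.castAdd n a) (xs P) := by
  rw [xs, Finset.map_insert, xs]; rfl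

/-- `ys` of an insertion. -/
lemma ys_insert (a : Fin n) (Q : Finset (Fin n)) : ys (insert a Q) = insert (Fin.natAdd n a) (ys Q) := by
  rw [ys, Finset.map_insert, ys]; rfl

/-- membership in `xs`. -/
lemma castAdd_mem_xs {a : Fin n} {P : Finset (Fin n)} : Fin.castAdd n a ∈ xs P ↔ a ∈ P := by
  simp only [xs, Finset.mem_map, Fin.castAddEmb_apply, Fin.castAdd_inj, exists_eq_right]

/-- membership in `ys`. -/
lemma natAdd_mem_ys {a : Fin n} {Q : Finset (Fin n)} : Fin.natAdd n a ∈ ys Q ↔ a ∈ Q := by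
  simp only [ys, Finset.mem_map, Fin.natAddEmb_apply, Fin.natAdd_inj, exists_eq_right]

/-- an `x`-index is never a `y`-index (stated for two block sizes `n`, `n'`; used at `n' = n`). -/
lemma castAdd_ne_natAdd {n' : ℕ} (a : Fin n) (c : Fin n') : Fin.castAdd n' a ≠ Fin.natAdd n c := by
  intro h
  have h' := congrArg Fin.val h
  simp only [Fin.val_castAdd, Fin.val_natAdd] at h'
  have := a.isLt
  omega

/-- `x`-indices do not lie in `ys`. -/
lemma castAdd_notMem_ys (a : Fin n) (Q : Finset (Fin n)) : Fin.castAdd n a ∉ ys Q := by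
  rw [ys, Finset.mem_map]
  rintro ⟨c, -, hc⟩
  exact castAdd_ne_natAdd a c hc.symm

/-- `y`-indices do not lie in `xs`. -/
lemma natAdd_notMem_xs (a : Fin n) (P : Finset (Fin n)) : Fin.natAdd n a ∉ xs P := by
  rw [xs, Finset.mem_map]
  rintro ⟨c, -, hc⟩
  exact castAdd_ne_natAdd c a hc

/-- `xs P` and `ys Q` are disjoint. -/
lemma disjoint_xs_ys (P Q : Finset (Fin n)) : Disjoint (xs P) (ys Q) := by
  rw [Finset.disjoint_left]
  intro i hi hi'
  obtain ⟨a, -, rfl⟩ := Finset.mem_map.mp hi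
  exact castAdd_notMem_ys a Q hi'

/-- cardinality of `xs`. -/
lemma card_xs (P : Finset (Fin n)) : (xs P).card = P.card := Finset.card_map _

/-- cardinality of `ys`. -/
lemma card_ys (Q : Finset (Fin n)) : (ys Q).card = Q.card := Finset.card_map _

/-- a monomial times a fresh generator on the left: `E_{i} ∧ E_t = c • E_{insert i t}` with `c ≠ 0`. -/
lemma gx_mul_B {I : Type*} [LinearOrder I] [Fintype I] {i : I} {t : Finset I} (hi : i ∉ t) :
    ∃ c : K, c ≠ 0 ∧ gx K i * B K I t = c • B K I (insert i t) :=
  ⟨u K {i} t, (u_ne_zero_iff K).mpr (Finset.disjoint_singleton_left.mpr hi), by rw [gx, B_mul_B, Finset.insert_eq]⟩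

/-- **`sym (x_P) = c · u_P`** (`c ≠ 0`): the pure-`x` monomial goes to the same monomial in the `u`'s, in `t`-degree `0`. -/
lemma sym_B_xs (P : Finset (Fin n)) :
    ∃ c : K, c ≠ 0 ∧ sym K (B K (In n) (xs P)) = c • Polynomial.monomial 0 (B K (Fin n) P) := by
  induction P using Finset.induction_on with
  | empty =>
    refine ⟨1, one_ne_zero, ?_⟩
    rw [xs, Finset.map_empty, B_empty, map_one, B_fin_empty, Polynomial.monomial_zero_one, one_smul]
  | insert a P ha ih =>
    obtain ⟨c, hc, hP⟩ := ih
    obtain ⟨c₁, hc₁, h₁⟩ := gx_mul_B K (I := In n) (i := Fin.castAdd n a) (t := xs P) (by rw [castAdd_mem_xs]; exact ha)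
    obtain ⟨c₂, hc₂, h₂⟩ := gx_mul_B K (I := Fin n) (i := a) (t := P) ha
    refine ⟨c₁⁻¹ * c * c₂, by simp [hc, hc₁, hc₂], ?_⟩
    have h₁' : B K (In n) (insert (Fin.castAdd n a) (xs P)) = c₁⁻¹ • (gx K (Fin.castAdd n a) * B K (In n) (xs P)) := by
      rw [h₁, smul_smul, inv_mul_cancel₀ hc₁, one_smul]
    rw [xs_insert, h₁', map_smul, map_mul, hP, sym_gx_castAdd, mul_smul_comm, Polynomial.monomial_mul_monomial, h₂,
      ← Polynomial.smul_monomial, smul_smul, smul_smul]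

/-- **`sym (y_Q) = c · u_Q · t^{|Q|}`** (`c ≠ 0`). -/
lemma sym_B_ys (Q : Finset (Fin n)) :
    ∃ c : K, c ≠ 0 ∧ sym K (B K (In n) (ys Q)) = c • Polynomial.monomial Q.card (B K (Fin n) Q) := by
  induction Q using Finset.induction_on with
  | empty =>
    refine ⟨1, one_ne_zero, ?_⟩
    rw [ys, Finset.map_empty, B_empty, map_one, B_fin_empty, Finset.card_empty, Polynomial.monomial_zero_one, one_smul]
  | insert a Q ha ih =>
    obtain ⟨c, hc, hQ⟩ := ih
    obtain ⟨c₁, hc₁, h₁⟩ := gx_mul_B K (I := In n) (i := Fin.natAdd n a) (t := ys Q) (by rw [natAdd_mem_ys]; exact ha)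
    obtain ⟨c₂, hc₂, h₂⟩ := gx_mul_B K (I := Fin n) (i := a) (t := Q) ha
    refine ⟨c₁⁻¹ * c * c₂, by simp [hc, hc₁, hc₂], ?_⟩
    have h₁' : B K (In n) (insert (Fin.natAdd n a) (ys Q)) = c₁⁻¹ • (gx K (Fin.natAdd n a) * B K (In n) (ys Q)) := by
      rw [h₁, smul_smul, inv_mul_cancel₀ hc₁, one_smul]
    rw [ys_insert, h₁', map_smul, map_mul, hQ, sym_gx_natAdd, mul_smul_comm, Polynomial.monomial_mul_monomial, h₂,
      ← Polynomial.smul_monomial, smul_smul, smul_smul, Finset.card_insert_of_notMem ha, add_comm 1]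

end Summit.Ventures.HSemireg.Wedge.HankelSiegelIdeal
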